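import Summits.CriticalPhenomena.PercolationContinuityZ3.Theorems.PercNearOneGluingNoHeavyLowerTailSunflowerTBernZOne
import HarnessLib

/-!
# `NoHeavyLowerTail` (crux stmt-CriticalPhenomena-4575), abstract sunflower cubic: T-BERN — the MERGING steps of the reduction
# (two h-petals; an h-petal into a leveraged tight petal) and the certificate for all-γ-heavy families

Support file (seat `prim-ineq-prove-1` gen 65; `--supports stmt-CriticalPhenomena-4575`).  No `sorry`, no named facts.
Memo: run/shared/lean/prim/prim-ineq-prove-1/FINDING-REDUCTION-prove1-g65.md §1.

Three ingredients of the reduction of `TBern s b β V` to irreducible floor-free families (all in the vocabulary of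
`…SunflowerTBernFloor`: `AdmissibleOn`, `DomOn`; `A_j = s+(1−s)u_j`, `g_j = (1−s)m_j + s·vv_j`, `A₀ = s+(1−s)b`, `a₀ = (1−s)b+sβ`):
* **`domOn_of_gammaHeavy`** — if every petal is γ-heavy (`a₀A_j ≤ A₀g_j`), the family polynomial is dominated coefficientwise by
  the merged one (`coefDom_prodPoly_aligned`) and the budgets finish; every TIGHT petal (`m_j = u_j`) is γ-heavy
  (`gammaHeavy_of_tight`), so this covers every family without a slack petal.
* **`domOn_of_merge_h`** — two h-petals `i, j` (`u = m = b`): `(A₀X+g_i)(A₀X+g_j) ≤_coef (A₀X+a₀)(A₀X+g_ig_j/a₀)` because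
  `(g_i−a₀)(g_j−a₀) ≥ 0`, and the h-petal with `g' = g_ig_j/a₀` (i.e. `vv_i' = (g_ig_j/a₀ − (1−s)b)/s`) together with the other
  petals is admissible on `t.erase j` (`vv_i' ≤ vv_ivv_j/β`); so `DomOn` on `t.erase j` for the merged family gives `DomOn` on `t`.
* **`domOn_of_merge_hT`** — an h-petal `i` and a tight petal `r` with `β·m_r ≤ b·vv_r` ("leveraged"): `(A₀X+g_i)(A_rX+g_r) ≤_coef
  (A₀X+a₀)(A_rX+g_rg_i/a₀)` because `r` is γ-heavy, and `r' = (u_r, vv_r', m_r)` with `g_r' = g_rg_i/a₀` is admissible on `t.erase i`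
  (`vv_r' ≤ vv_rvv_i/β` uses `β m_r ≤ b vv_r`).
-/

noncomputable section

namespace Summit.CriticalPhenomena.PercolationContinuityZ3.Theorems.SunflowerPartition

namespace SafeCalc

namespace LinkedCurrency

open Finset Polynomial

variable {ι : Type*}

/-! ## Small polynomial facts -/

/-- `prodPoly` only depends on the values of `a`, `c` on the finset. [this work] -/
theorem prodPoly_congr {t : Finset ι} {a a' c c' : ι → ℝ} (ha : ∀ j ∈ t, a j = a' j) (hc : ∀ j ∈ t, c j = c' j) :
    prodPoly t a c = prodPoly t a' c' := by
  unfold prodPoly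
  exact prod_congr rfl fun j hj => by rw [ha j hj, hc j hj]

/-- The family polynomial of nonnegative data has nonnegative coefficients. [this work] -/
theorem coefNonneg_prodPoly [DecidableEq ι] (t : Finset ι) {a c : ι → ℝ} (ha : ∀ j ∈ t, 0 ≤ a j)
    (hc : ∀ j ∈ t, 0 ≤ c j) : CoefNonneg (prodPoly t a c) := by
  induction t using Finset.induction_on with
  | empty =>
    intro k
    unfold prodPoly
    rw [prod_empty, coeff_one]
    split_ifs <;> norm_num
  | @insert j s hj ih =>
    rw [prodPoly_insert hj]
    exact (coefNonneg_lin (ha j (mem_insert_self j s)) (hc j (mem_insert_self j s))).mul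
      (ih (fun i hi => ha i (mem_insert_of_mem hi)) (fun i hi => hc i (mem_insert_of_mem hi)))

/-! ## All-γ-heavy families -/

/-- **A tight petal is γ-heavy**: `m = u`, `b ≤ u`, `β ≤ vv`, `β ≤ 1`, `0 ≤ s ≤ 1` give `a₀(s+(1−s)u) ≤ A₀((1−s)m + s·vv)`.
(Indeed the difference is `s(1−s)(u−b)(1−β) + s²(vv−β) + s(1−s)(b·vv − βb) ≥ 0`.) [this work] -/
theorem gammaHeavy_of_tight {s b β u vv m : ℝ} (hs0 : 0 ≤ s) (hs1 : s ≤ 1) (hb : 0 ≤ b) (hβ1 : β ≤ 1) (hbu : b ≤ u)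
    (hβv : β ≤ vv) (hmu : m = u) :
    ((1 - s) * b + s * β) * (s + (1 - s) * u) ≤ (s + (1 - s) * b) * ((1 - s) * m + s * vv) := by
  rw [hmu]
  have hs' : 0 ≤ 1 - s := sub_nonneg.2 hs1
  have h1 : 0 ≤ s * (1 - s) * ((u - b) * (1 - β)) :=
    mul_nonneg (mul_nonneg hs0 hs') (mul_nonneg (sub_nonneg.2 hbu) (sub_nonneg.2 hβ1))
  have h2 : 0 ≤ s * s * (vv - β) := mul_nonneg (mul_nonneg hs0 hs0) (sub_nonneg.2 hβv)
  have h3 : 0 ≤ s * (1 - s) * (b * (vv - β)) := mul_nonneg (mul_nonneg hs0 hs') (mul_nonneg hb (sub_nonneg.2 hβv))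
  nlinarith

/-- `∏ α_j ≤ α(∏ x_j)` for `κ ∈ [0,1]`, `x_j ≥ 1` (`α(x) = 1 + κ(x−1)`), together with `1 ≤ ∏ x_j`. [this work] -/
theorem prod_alpha_le [DecidableEq ι] {κ : ℝ} (hκ0 : 0 ≤ κ) (hκ1 : κ ≤ 1) (t : Finset ι) {x : ι → ℝ}
    (hx : ∀ j ∈ t, 1 ≤ x j) :
    ∏ j ∈ t, (1 + κ * (x j - 1)) ≤ 1 + κ * (∏ j ∈ t, x j - 1) ∧ 1 ≤ ∏ j ∈ t, x j := by
  induction t using Finset.induction_on with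
  | empty => simp
  | @insert j s hj ih =>
    obtain ⟨h1, h2⟩ := ih fun i hi => hx i (mem_insert_of_mem hi)
    have hxj : 1 ≤ x j := hx j (mem_insert_self j s)
    rw [prod_insert hj, prod_insert hj]
    have hαj0 : 0 ≤ 1 + κ * (x j - 1) := by have := mul_nonneg hκ0 (sub_nonneg.2 hxj); linarith
    refine ⟨?_, one_le_mul_of_one_le_of_one_le hxj h2⟩
    calc (1 + κ * (x j - 1)) * ∏ i ∈ s, (1 + κ * (x i - 1)) ≤ (1 + κ * (x j - 1)) * (1 + κ * (∏ i ∈ s, x i - 1)) :=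
          mul_le_mul_of_nonneg_left h1 hαj0
      _ = (1 + κ * (∏ i ∈ s, x i - 1)) * (1 + κ * (x j - 1)) := mul_comm _ _
      _ ≤ 1 + κ * ((∏ i ∈ s, x i) * x j - 1) := alpha_mul_le hκ0 hκ1 h2 hxj
      _ = 1 + κ * (x j * ∏ i ∈ s, x i - 1) := by rw [mul_comm (∏ i ∈ s, x i)]

/-- **The `TBern` certificate for every nonempty admissible family all of whose petals are γ-heavy** (`a₀A_j ≤ A₀g_j`).
[this work] -/
theorem domOn_of_gammaHeavy [DecidableEq ι] {s b β V : ℝ} (hb : 0 < b) (hbβ : b ≤ β) (hs0 : 0 ≤ s) (hs1 : s ≤ 1)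
    {t : Finset ι} (ht : t.Nonempty) {u vv m : ι → ℝ} (hadm : AdmissibleOn s b β V t u vv m)
    (hheavy : ∀ j ∈ t, ((1 - s) * b + s * β) * (s + (1 - s) * u j) ≤ (s + (1 - s) * b) * ((1 - s) * m j + s * vv j)) :
    DomOn s b β V t u vv m := by
  obtain ⟨hub, hu1, hvβ, _, hmb, _, _, hpu, _, hpg⟩ := hadm
  have hs' : 0 ≤ 1 - s := sub_nonneg.2 hs1
  set A₀ := s + (1 - s) * b with hA₀d
  set a₀ := (1 - s) * b + s * β with ha₀d
  have hb1 : b ≤ 1 := by obtain ⟨j, hj⟩ := ht; exact (hub j hj).trans (hu1 j hj)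
  have hA₀ : 0 < A₀ := by
    have : 0 ≤ s * (1 - b) := mul_nonneg hs0 (sub_nonneg.2 hb1)
    have e : A₀ = b + s * (1 - b) := by rw [hA₀d]; ring
    rw [e]; linarith
  have ha₀ : 0 < a₀ := by
    have : 0 ≤ s * (β - b) := mul_nonneg hs0 (sub_nonneg.2 hbβ)
    have e : a₀ = b + s * (β - b) := by rw [ha₀d]; ring
    rw [e]; linarith
  set κ := (1 - s) * b / A₀ with hκ
  have hκ0 : 0 ≤ κ := div_nonneg (mul_nonneg hs' hb.le) hA₀.le
  have hκ1 : κ ≤ 1 := by rw [hκ, div_le_one hA₀, hA₀d]; linarith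
  set x : ι → ℝ := fun j => u j / b with hxd
  set α : ι → ℝ := fun j => (s + (1 - s) * u j) / A₀ with hαd
  set γ : ι → ℝ := fun j => ((1 - s) * m j + s * vv j) / a₀ with hγd
  have hx : ∀ j ∈ t, 1 ≤ x j := fun j hj => by rw [hxd]; exact (one_le_div hb).2 (hub j hj)
  have hα : ∀ j, α j = 1 + κ * (x j - 1) := by
    intro j
    rw [hαd, hκ, hxd]
    field_simp
    rw [hA₀d]; ring
  have hα1 : ∀ j ∈ t, 1 ≤ α j := fun j hj => by
    rw [hα]; have := mul_nonneg hκ0 (sub_nonneg.2 (hx j hj)); linarith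
  have hαγ : ∀ j ∈ t, α j ≤ γ j := fun j hj => by
    rw [hαd, hγd, div_le_div_iff₀ hA₀ ha₀]
    have := hheavy j hj
    linarith
  have hγ1 : ∀ j ∈ t, 1 ≤ γ j := fun j hj => (hα1 j hj).trans (hαγ j hj)
  -- coefficientwise merge of the aligned family
  have key := coefDom_prodPoly_aligned t ht α γ hα1 hγ1 (Or.inr hαγ)
  -- budgets: ∏α ≤ α(∏x) ≤ 1/A₀ and ∏γ ≤ V/a₀
  have hX : ∏ j ∈ t, x j ≤ 1 / b := by
    rw [hxd, prod_div_distrib, prod_const, div_le_div_iff₀ (pow_pos hb _) hb, one_mul]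
    calc (∏ j ∈ t, u j) * b ≤ b ^ (t.card - 1) * b := mul_le_mul_of_nonneg_right hpu hb.le
      _ = b ^ t.card := by rw [← pow_succ]; congr 1; have := ht.card_pos; omega
  have hαprod : ∏ j ∈ t, α j ≤ 1 / A₀ := by
    obtain ⟨h1, _⟩ := prod_alpha_le hκ0 hκ1 t hx
    have e : ∏ j ∈ t, α j = ∏ j ∈ t, (1 + κ * (x j - 1)) := prod_congr rfl fun j _ => hα j
    rw [e]
    refine h1.trans ?_
    have h2 : 1 + κ * (∏ j ∈ t, x j - 1) ≤ 1 + κ * (1 / b - 1) := by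
      have := mul_le_mul_of_nonneg_left (sub_le_sub_right hX 1) hκ0; linarith
    have h3 : 1 + κ * (1 / b - 1) = 1 / A₀ := by
      rw [hκ, eq_div_iff hA₀.ne']
      have e1 : (1 + (1 - s) * b / A₀ * (1 / b - 1)) * A₀ = A₀ + (1 - s) * b * (1 / b - 1) := by field_simp
      have e2 : (1 - s) * b * (1 / b - 1) = (1 - s) * (1 - b) := by field_simp
      rw [e1, e2, hA₀d]; ring
    linarith
  have hG : ∏ j ∈ t, γ j ≤ V / a₀ := by
    rw [hγd, prod_div_distrib, prod_const, div_le_div_iff₀ (pow_pos ha₀ _) ha₀]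
    calc (∏ j ∈ t, ((1 - s) * m j + s * vv j)) * a₀ ≤ a₀ ^ (t.card - 1) * V * a₀ :=
          mul_le_mul_of_nonneg_right hpg ha₀.le
      _ = V * a₀ ^ t.card := by
          have hc : t.card = (t.card - 1) + 1 := by have := ht.card_pos; omega
          conv_rhs => rw [hc, pow_succ]
          ring
  have hfl : CoefNonneg ((C (1 : ℝ) * X + C 1) ^ (t.card - 1)) := (coefNonneg_lin zero_le_one zero_le_one).pow _
  have key2 : CoefDom (prodPoly t α γ) ((C 1 * X + C 1) ^ (t.card - 1) * (C (1 / A₀) * X + C (V / a₀))) :=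
    key.trans ((coefDom_lin hαprod hG).mul_left hfl)
  exact domOn_of_normalised hA₀ ha₀ ht key2

/-! ## Merging two h-petals -/

/-- **The two-h merge, polynomial form**: `(A₀X+g_i)(A₀X+g_j) ≤_coef (A₀X+a₀)(A₀X+g')` when `a₀g' = g_ig_j`, `a₀ ≤ g_i, g_j`,
`0 < a₀`. [this work] -/
theorem coefDom_merge_h {A₀ a₀ gi gj g' : ℝ} (hA₀ : 0 ≤ A₀) (ha₀ : 0 < a₀) (hgi : a₀ ≤ gi) (hgj : a₀ ≤ gj)
    (hg' : a₀ * g' = gi * gj) :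
    CoefDom ((C A₀ * X + C gi) * (C A₀ * X + C gj)) ((C A₀ * X + C a₀) * (C A₀ * X + C g')) := by
  refine coefDom_step (le_of_eq (by ring)) (by rw [hg']) ?_
  -- `A₀ g_j + g_i A₀ ≤ A₀ g' + a₀ A₀` ⟸ `g_i + g_j ≤ g' + a₀` ⟸ `(g_i − a₀)(g_j − a₀) ≥ 0`
  have h1 : 0 ≤ (gi - a₀) * (gj - a₀) := mul_nonneg (sub_nonneg.2 hgi) (sub_nonneg.2 hgj)
  have h2 : a₀ * (gi + gj) ≤ a₀ * (g' + a₀) := by nlinarith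
  have h3 : gi + gj ≤ g' + a₀ := le_of_mul_le_mul_left h2 ha₀
  nlinarith [mul_le_mul_of_nonneg_left h3 hA₀]

/-! ## The transfer lemma for a pair merge -/

/-- **Pair-merge transfer.**  If the two petals `j, i ∈ t` satisfy `ℓ_j·ℓ_i ≤_coef (A₀X+a₀)·ℓ_i'` where `ℓ_i'` is the petal `i`
with `vv_i` replaced by `vv'_i` (and `vv' = vv` elsewhere on `t`), then `DomOn` for the merged family on `t.erase j` gives
`DomOn` for the original family on `t`. [this work] -/
theorem domOn_of_merge_pair [DecidableEq ι] {s b β V : ℝ} (hs0 : 0 ≤ s) (hs1 : s ≤ 1) (hb : 0 ≤ b) (hβ : 0 ≤ β)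
    {t : Finset ι} {u vv m vv' : ι → ℝ} {i j : ι} (hij : i ≠ j) (hi : i ∈ t) (hj : j ∈ t)
    (hu0 : ∀ k ∈ t, 0 ≤ u k) (hm0 : ∀ k ∈ t, 0 ≤ m k) (hv0 : ∀ k ∈ t, 0 ≤ vv k)
    (hvv' : ∀ k ∈ t, k ≠ i → vv' k = vv k)
    (hstep : CoefDom ((C (s + (1 - s) * u j) * X + C ((1 - s) * m j + s * vv j)) *
        (C (s + (1 - s) * u i) * X + C ((1 - s) * m i + s * vv i)))
      ((C (s + (1 - s) * b) * X + C ((1 - s) * b + s * β)) * (C (s + (1 - s) * u i) * X + C ((1 - s) * m i + s * vv' i))))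
    (hdom : DomOn s b β V (t.erase j) u vv' m) : DomOn s b β V t u vv m := by
  have hs' : 0 ≤ 1 - s := sub_nonneg.2 hs1
  set a : ι → ℝ := fun k => s + (1 - s) * u k with had
  set c : ι → ℝ := fun k => (1 - s) * m k + s * vv k with hcd
  set c' : ι → ℝ := fun k => (1 - s) * m k + s * vv' k with hc'd
  have hjt : j ∉ t.erase j := notMem_erase j t
  have hit' : i ∈ t.erase j := mem_erase.2 ⟨hij, hi⟩
  have hit'' : i ∉ (t.erase j).erase i := notMem_erase i _
  set R := prodPoly ((t.erase j).erase i) a c with hRd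
  have hR : CoefNonneg R := coefNonneg_prodPoly _ (fun k hk => by
      have hk' := mem_of_mem_erase (mem_of_mem_erase hk)
      show 0 ≤ s + (1 - s) * u k
      exact add_nonneg hs0 (mul_nonneg hs' (hu0 k hk')))
    (fun k hk => by
      have hk' := mem_of_mem_erase (mem_of_mem_erase hk)
      show 0 ≤ (1 - s) * m k + s * vv k
      exact add_nonneg (mul_nonneg hs' (hm0 k hk')) (mul_nonneg hs0 (hv0 k hk')))
  have hR' : prodPoly ((t.erase j).erase i) a c' = R := by
    refine prodPoly_congr (fun k _ => rfl) (fun k hk => ?_)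
    have hk' : k ∈ t := mem_of_mem_erase (mem_of_mem_erase hk)
    have hki : k ≠ i := (mem_erase.1 hk).1
    show (1 - s) * m k + s * vv' k = (1 - s) * m k + s * vv k
    rw [hvv' k hk' hki]
  -- factorizations
  have e1 : prodPoly t a c = (C (a j) * X + C (c j)) * ((C (a i) * X + C (c i)) * R) := by
    rw [hRd]
    conv_lhs => rw [← insert_erase hj, prodPoly_insert hjt, ← insert_erase hit', prodPoly_insert hit'']
  have e2 : prodPoly (t.erase j) a c' = (C (a i) * X + C (c' i)) * R := by
    rw [← hR']
    conv_lhs => rw [← insert_erase hit', prodPoly_insert hit'']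
  have hcard : t.card - 1 = ((t.erase j).card - 1) + 1 := by
    rw [card_erase_of_mem hj]
    have : 2 ≤ t.card := by
      have h1 : (t.erase j).card ≥ 1 := card_pos.2 ⟨i, hit'⟩
      rw [card_erase_of_mem hj] at h1; omega
    omega
  unfold DomOn at hdom ⊢
  rw [e1, hcard, pow_succ]
  rw [e2] at hdom
  have hlin : CoefNonneg (C (s + (1 - s) * b) * X + C ((1 - s) * b + s * β)) :=
    coefNonneg_lin (add_nonneg hs0 (mul_nonneg hs' hb)) (add_nonneg (mul_nonneg hs' hb) (mul_nonneg hs0 hβ))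
  have step1 : CoefDom ((C (a j) * X + C (c j)) * ((C (a i) * X + C (c i)) * R))
      (((C (s + (1 - s) * b) * X + C ((1 - s) * b + s * β)) * (C (a i) * X + C (c' i))) * R) := by
    have := hstep.mul_right hR
    refine (this.of_eq_left ?_)
    ring
  have step2 := hdom.mul_left hlin
  refine (step1.trans (step2.of_eq_left ?_)).of_eq_right ?_
  · ring
  · ring

/-! ## Merging two h-petals -/

/-- **The two-h merge keeps admissibility.**  Two h-petals `i ≠ j` (`u_j = b`, `m_i = m_j = b`) of an admissible family,
`0 < s ≤ 1`; `v'` with `a₀((1−s)b + s·v') = g_ig_j`.  Then the family on `t.erase j` with `vv_i := v'` is admissible.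
[this work] -/
theorem admissibleOn_merge_h [DecidableEq ι] {s b β V : ℝ} (hb : 0 < b) (hbβ : b ≤ β) (hs0 : 0 < s) (hs1 : s ≤ 1)
    {t : Finset ι} {u vv m : ι → ℝ} (hadm : AdmissibleOn s b β V t u vv m) {i j : ι} (hij : i ≠ j) (hi : i ∈ t)
    (hj : j ∈ t) (hmi : m i = b) (huj : u j = b) (hmj : m j = b) {v' : ℝ}
    (hv' : ((1 - s) * b + s * β) * ((1 - s) * b + s * v') = ((1 - s) * b + s * vv i) * ((1 - s) * b + s * vv j)) :
    AdmissibleOn s b β V (t.erase j) u (Function.update vv i v') m := by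
  obtain ⟨hub, hu1, hvβ, hv1, hmb, hmu, hmv, hpu, hpv, hpg⟩ := hadm
  have hs' : 0 ≤ 1 - s := sub_nonneg.2 hs1
  have hβ : 0 < β := hb.trans_le hbβ
  have ha₀ : 0 < (1 - s) * b + s * β := by nlinarith
  have hvi : β ≤ vv i := hvβ i hi
  have hvj : β ≤ vv j := hvβ j hj
  -- v' ≥ vv_i (because g_j ≥ a₀) and β v' ≤ vv_i vv_j
  have hgj : (1 - s) * b + s * β ≤ (1 - s) * b + s * vv j := by nlinarith
  have hv'ge : vv i ≤ v' := by
    have hgi0 : 0 ≤ (1 - s) * b + s * vv i := by nlinarith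
    have h1 : ((1 - s) * b + s * vv i) * ((1 - s) * b + s * β) ≤ ((1 - s) * b + s * vv i) * ((1 - s) * b + s * vv j) :=
      mul_le_mul_of_nonneg_left hgj hgi0
    have h2 : ((1 - s) * b + s * β) * ((1 - s) * b + s * vv i) ≤ ((1 - s) * b + s * β) * ((1 - s) * b + s * v') := by
      rw [hv']; linarith
    have h3 := le_of_mul_le_mul_left h2 ha₀
    have h4 : s * vv i ≤ s * v' := by linarith
    exact le_of_mul_le_mul_left h4 hs0
  have hv'le : β * v' ≤ vv i * vv j := by
    have key : ((1 - s) * b + s * β) * ((1 - s) * b * β + s * (vv i * vv j)) -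
        β * (((1 - s) * b + s * vv i) * ((1 - s) * b + s * vv j)) = s * (1 - s) * b * ((vv i - β) * (vv j - β)) := by ring
    have hpos : 0 ≤ s * (1 - s) * b * ((vv i - β) * (vv j - β)) :=
      mul_nonneg (mul_nonneg (mul_nonneg hs0.le hs') hb.le) (mul_nonneg (sub_nonneg.2 hvi) (sub_nonneg.2 hvj))
    have h2 : ((1 - s) * b + s * β) * (β * ((1 - s) * b + s * v')) ≤
        ((1 - s) * b + s * β) * ((1 - s) * b * β + s * (vv i * vv j)) := by
      have e : ((1 - s) * b + s * β) * (β * ((1 - s) * b + s * v')) =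
          β * (((1 - s) * b + s * β) * ((1 - s) * b + s * v')) := by ring
      rw [e, hv']; linarith
    have h3 := le_of_mul_le_mul_left h2 ha₀
    have h4 : s * (β * v') ≤ s * (vv i * vv j) := by linarith
    exact le_of_mul_le_mul_left h4 hs0
  have hit' : i ∈ t.erase j := mem_erase.2 ⟨hij, hi⟩
  have hcard : t.card - 1 = ((t.erase j).card - 1) + 1 := by
    rw [card_erase_of_mem hj]
    have h1 : (t.erase j).card ≥ 1 := card_pos.2 ⟨i, hit'⟩
    rw [card_erase_of_mem hj] at h1; omega
  have sub : ∀ {p : ι → Prop}, (∀ k ∈ t, p k) → ∀ k ∈ t.erase j, p k := fun hp k hk => hp k (mem_of_mem_erase hk)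
  have hupd_i : Function.update vv i v' i = v' := Function.update_self i v' vv
  have hupd : ∀ k, k ≠ i → Function.update vv i v' k = vv k := fun k hk => Function.update_of_ne hk v' vv
  -- vv_i vv_j ≤ β V from the vv-budget
  have hijV : vv i * vv j ≤ β * V := by
    have hrest : β ^ ((t.erase j).erase i).card ≤ ∏ l ∈ (t.erase j).erase i, vv l := by
      calc β ^ ((t.erase j).erase i).card = ∏ l ∈ (t.erase j).erase i, β := by rw [prod_const]
        _ ≤ ∏ l ∈ (t.erase j).erase i, vv l := prod_le_prod (fun _ _ => hβ.le)
            fun l hl => hvβ l (mem_of_mem_erase (mem_of_mem_erase hl))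
    have hsplit : ∏ l ∈ t, vv l = vv j * (vv i * ∏ l ∈ (t.erase j).erase i, vv l) := by
      rw [mul_prod_erase (t.erase j) vv hit', mul_prod_erase t vv hj]
    have hβpow : 0 < β ^ ((t.erase j).erase i).card := pow_pos hβ _
    have h1 : vv j * (vv i * β ^ ((t.erase j).erase i).card) ≤ β ^ (t.card - 1) * V := by
      calc vv j * (vv i * β ^ ((t.erase j).erase i).card) ≤ vv j * (vv i * ∏ l ∈ (t.erase j).erase i, vv l) :=
            mul_le_mul_of_nonneg_left (mul_le_mul_of_nonneg_left hrest (hβ.le.trans hvi)) (hβ.le.trans hvj)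
        _ = ∏ l ∈ t, vv l := hsplit.symm
        _ ≤ β ^ (t.card - 1) * V := hpv
    have e : β ^ (t.card - 1) = β ^ ((t.erase j).erase i).card * β := by
      rw [← pow_succ]; congr 1
      rw [card_erase_of_mem hit', card_erase_of_mem hj]; omega
    rw [e] at h1
    have h3 : (vv i * vv j) * β ^ ((t.erase j).erase i).card ≤ (β * V) * β ^ ((t.erase j).erase i).card := by
      nlinarith
    exact le_of_mul_le_mul_right h3 hβpow
  refine ⟨sub hub, sub hu1, ?_, ?_, sub hmb, sub hmu, ?_, ?_, ?_, ?_⟩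
  · intro k hk
    by_cases hki : k = i
    · rw [hki, hupd_i]; exact hvi.trans hv'ge
    · rw [hupd k hki]; exact hvβ k (mem_of_mem_erase hk)
  · intro k hk
    by_cases hki : k = i
    · rw [hki, hupd_i]
      have h4 : β * v' ≤ β * V := hv'le.trans hijV
      exact le_of_mul_le_mul_left h4 hβ
    · rw [hupd k hki]; exact hv1 k (mem_of_mem_erase hk)
  · intro k hk
    by_cases hki : k = i
    · rw [hki, hupd_i, hmi]; exact hbβ.trans (hvi.trans hv'ge)
    · rw [hupd k hki]; exact hmv k (mem_of_mem_erase hk)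
  · -- u-budget: ∏_{t∖j} u = (∏_t u)/b
    rw [← mul_prod_erase t u hj, huj, hcard, pow_succ, mul_comm (b ^ _) b] at hpu
    exact le_of_mul_le_mul_left hpu hb
  · -- vv-budget
    have hsplit : ∏ l ∈ t.erase j, Function.update vv i v' l = v' * ∏ l ∈ (t.erase j).erase i, vv l := by
      rw [← mul_prod_erase (t.erase j) _ hit', hupd_i]
      congr 1
      exact prod_congr rfl fun l hl => hupd l (mem_erase.1 hl).1
    have hsplit2 : ∏ l ∈ t, vv l = vv j * (vv i * ∏ l ∈ (t.erase j).erase i, vv l) := by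
      rw [mul_prod_erase (t.erase j) vv hit', mul_prod_erase t vv hj]
    have hrest0 : 0 ≤ ∏ l ∈ (t.erase j).erase i, vv l :=
      prod_nonneg fun l hl => hβ.le.trans (hvβ l (mem_of_mem_erase (mem_of_mem_erase hl)))
    rw [hsplit]
    rw [hsplit2, hcard, pow_succ] at hpv
    have h1 : β * (v' * ∏ l ∈ (t.erase j).erase i, vv l) ≤ β * (β ^ ((t.erase j).card - 1) * V) := by
      calc β * (v' * ∏ l ∈ (t.erase j).erase i, vv l) = (β * v') * ∏ l ∈ (t.erase j).erase i, vv l := by ring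
        _ ≤ (vv i * vv j) * ∏ l ∈ (t.erase j).erase i, vv l := mul_le_mul_of_nonneg_right hv'le hrest0
        _ = vv j * (vv i * ∏ l ∈ (t.erase j).erase i, vv l) := by ring
        _ ≤ β ^ ((t.erase j).card - 1) * β * V := hpv
        _ = β * (β ^ ((t.erase j).card - 1) * V) := by ring
    exact le_of_mul_le_mul_left h1 hβ
  · -- g-budget
    have hsplit : ∏ l ∈ t.erase j, ((1 - s) * m l + s * Function.update vv i v' l) =
        ((1 - s) * b + s * v') * ∏ l ∈ (t.erase j).erase i, ((1 - s) * m l + s * vv l) := by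
      rw [← mul_prod_erase (t.erase j) _ hit', hupd_i, hmi]
      congr 1
      exact prod_congr rfl fun l hl => by rw [hupd l (mem_erase.1 hl).1]
    have hsplit2 : ∏ l ∈ t, ((1 - s) * m l + s * vv l) =
        ((1 - s) * m j + s * vv j) * (((1 - s) * m i + s * vv i) * ∏ l ∈ (t.erase j).erase i, ((1 - s) * m l + s * vv l)) := by
      rw [mul_prod_erase (t.erase j) (fun l => (1 - s) * m l + s * vv l) hit',
        mul_prod_erase t (fun l => (1 - s) * m l + s * vv l) hj]
    have hrest0 : 0 ≤ ∏ l ∈ (t.erase j).erase i, ((1 - s) * m l + s * vv l) :=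
      prod_nonneg fun l hl => by
        have hl' := mem_of_mem_erase (mem_of_mem_erase hl)
        exact add_nonneg (mul_nonneg hs' (hb.le.trans (hmb l hl'))) (mul_nonneg hs0.le (hβ.le.trans (hvβ l hl')))
    rw [hsplit]
    rw [hsplit2, hcard, pow_succ] at hpg
    have h1 : ((1 - s) * b + s * β) * (((1 - s) * b + s * v') * ∏ l ∈ (t.erase j).erase i, ((1 - s) * m l + s * vv l)) ≤
        ((1 - s) * b + s * β) * (((1 - s) * b + s * β) ^ ((t.erase j).card - 1) * V) := by
      calc ((1 - s) * b + s * β) * (((1 - s) * b + s * v') * ∏ l ∈ (t.erase j).erase i, ((1 - s) * m l + s * vv l))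
          = (((1 - s) * b + s * β) * ((1 - s) * b + s * v')) * ∏ l ∈ (t.erase j).erase i, ((1 - s) * m l + s * vv l) := by
            ring
        _ = ((1 - s) * m j + s * vv j) * (((1 - s) * m i + s * vv i) *
              ∏ l ∈ (t.erase j).erase i, ((1 - s) * m l + s * vv l)) := by rw [hv', hmi, hmj]; ring
        _ ≤ ((1 - s) * b + s * β) ^ ((t.erase j).card - 1) * ((1 - s) * b + s * β) * V := hpg
        _ = ((1 - s) * b + s * β) * (((1 - s) * b + s * β) ^ ((t.erase j).card - 1) * V) := by ring
    exact le_of_mul_le_mul_left h1 ha₀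

/-- **Merging two h-petals.**  With the data of `admissibleOn_merge_h` (and `u_i = b`): `DomOn` for the merged family on `t.erase j`
implies `DomOn` for the original family on `t`. [this work] -/
theorem domOn_of_merge_h [DecidableEq ι] {s b β V : ℝ} (hb : 0 < b) (hbβ : b ≤ β) (hs0 : 0 < s) (hs1 : s ≤ 1)
    {t : Finset ι} {u vv m : ι → ℝ} (hadm : AdmissibleOn s b β V t u vv m) {i j : ι} (hij : i ≠ j) (hi : i ∈ t)
    (hj : j ∈ t) (hui : u i = b) (hmi : m i = b) (huj : u j = b) (hmj : m j = b) {v' : ℝ}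
    (hv' : ((1 - s) * b + s * β) * ((1 - s) * b + s * v') = ((1 - s) * b + s * vv i) * ((1 - s) * b + s * vv j))
    (hdom : DomOn s b β V (t.erase j) u (Function.update vv i v') m) : DomOn s b β V t u vv m := by
  obtain ⟨hub, _, hvβ, _, hmb, _, _, _, _, _⟩ := hadm
  have hs' : 0 ≤ 1 - s := sub_nonneg.2 hs1
  have hβ : 0 < β := hb.trans_le hbβ
  have ha₀ : 0 < (1 - s) * b + s * β := by nlinarith
  refine domOn_of_merge_pair hs0.le hs1 hb.le hβ.le hij hi hj (fun k hk => hb.le.trans (hub k hk))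
    (fun k hk => hb.le.trans (hmb k hk)) (fun k hk => hβ.le.trans (hvβ k hk))
    (fun k _ hki => Function.update_of_ne hki v' vv) ?_ hdom
  rw [Function.update_self, hui, huj, hmi, hmj]
  refine coefDom_merge_h (by nlinarith) ha₀ (by nlinarith [hvβ j hj]) (by nlinarith [hvβ i hi]) ?_
  linarith [hv']

end LinkedCurrency

end SafeCalc

end Summit.CriticalPhenomena.PercolationContinuityZ3.Theorems.SunflowerPartition
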